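import Mathlib
import Summits.ValiantsHypothesis.ValiantsHypothesis.Theorems.FifoMatchingNNLinearDegreeCofactorHardGoodCarving
import Summits.ValiantsHypothesis.ValiantsHypothesis.Theorems.FifoMatchingNNLinearDegreeCofactorHardPushforwardMeasure
import HarnessLib

/-!
# Route FifoMatching — crux `NNLinearDegreeCofactorHard` (stmt-ValiantsHypothesis-23918), line `internal_cofactor`:
# stub S2b — the assembly target in COUNTING form (`AvoidingCounts ⇒ S2b`)

This file composes the landed reductions of the AvoidingSpread interface into the form the remaining units
((A″) word, (C″-d) test pricing, (D″) many boundaries, (E″) band; SPEC `Lines/internal_cofactor-S2b-SPEC.md`)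
actually produce: COUNTS over a finite set of seeds.  `denseInternalHard_of_counts (a)`: the body of stub S2b
(`stub_denseInternalHard`) with the constant `a ≥ 28` follows as soon as, for every `c`, eventually in `n`,
for every admissible `R` and EVERY carving `C` of `[2n]` with good ends (SPEC S0: the trace
`R' = {j : C.a + j ∈ R}` has density `≤ 1/4` on every prefix and suffix of `Fin (2·C.m)`), `3 ≤ C.m` and
`2n ≤ 2·C.m + 12|R| + 4`, one exhibits a bit length `B`, a nonempty seed set `BB ⊆ (Fin B → Bool)` and a map
`f` from seeds to `R'`-AVOIDING nest-free perfect matchings of `Fin (2·C.m)` such that for every balanced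
`S ⊆ Fin (2·C.m)` (`2·C.m < 3|S| ≤ 4·C.m`):
`4·(2^((log₂ n + c)^c) + 1)·(C.m + 1)² · #{y ∈ BB : f y respects S} < #BB`.
Chain: `exists_good_carving` (S0 + outer witness, `…GoodCarving`) → push-forward of the uniform law on `BB`
(`…PushforwardMeasure`) → `denseInternalHard_of_excisedAvoidingSpread` (`…Excision`: cofactor removal +
excision + family union bound).  No hypothesis on `R` beyond the stub's own.

Honest framing: a reduction for one stub of an OPEN crux; S2b, the crux, `NNDivisionHard`, `NNNotVP` stay
open; monotone ≠ general (`…Barriers.ValiantsHypothesis.MonotoneGap`); nothing here bears on `VP ≠ VNP`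
(NOT proved).  No definitions, no named facts. [folklore]
-/

noncomputable section

-- Sub = Summit single-conjunct layout: the duplicated namespace component is mandated by the tree.
set_option linter.dupNamespace false

namespace Summit.ValiantsHypothesis.ValiantsHypothesis.Theorems.FifoMatching.NNLinearDegreeCofactorHard.InternalCofactor

open MvPolynomial Finset Literature.Computability.AlgebraicComplexity
open Summit.ValiantsHypothesis.ValiantsHypothesis.Theorems.FifoMatching.NNLowDegreeCofactorHard.FreedVertices.Carve
open scoped NNReal

/-- **S2b from counts (`AvoidingCounts(a) ⇒ stub_denseInternalHard` with this `a`).**  See the module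
docstring.  The seeds `BB`, the map `f` and the count are what SPEC units (A″)/(C″-d)/(D″)/(E″) deliver
(`BB` = band bit strings, `f y = fifo (inflateWord R' L m y)`, count = block tests × many boundaries);
the carving, its good ends, the outer witness, the measure and the union bound are supplied here.
[folklore] -/
theorem denseInternalHard_of_counts (a : ℕ) (ha : 28 ≤ a)
    (h : ∀ c : ℕ, ∃ n₀ : ℕ, ∀ n ≥ n₀, ∀ R : Finset (Fin (2 * n)), a * R.card ≤ 2 * n →
      (¬ ∃ s : ℕ, s + (2 * ((Nat.log 2 n + c) ^ c + Nat.log 2 n + 1) ^ 6 + 12) ≤ 2 * n ∧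
        ∀ j : Fin (2 * n), s ≤ j.val →
          j.val < s + (2 * ((Nat.log 2 n + c) ^ c + Nat.log 2 n + 1) ^ 6 + 12) → j ∉ R) →
      ∀ C : Carving n, 3 ≤ C.m → 2 * n ≤ 2 * C.m + 12 * R.card + 4 →
        (∀ t ≤ 2 * C.m,
          4 * ((univ.filter fun j : Fin (2 * C.m) => C.up j ∈ R).filter fun j => j.val < t).card ≤ t ∧
          4 * ((univ.filter fun j : Fin (2 * C.m) => C.up j ∈ R).filter
            fun j => 2 * C.m ≤ j.val + t).card ≤ t) →
        ∃ B : ℕ, ∃ BB : Finset (Fin B → Bool), ∃ f : (Fin B → Bool) → (Fin (2 * C.m) → Fin (2 * C.m)),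
          BB.Nonempty ∧
          (∀ y ∈ BB, f y ∈ (nestFreeMatchings (2 * C.m)).filter
            (fun N => ∀ j ∈ (univ.filter fun j : Fin (2 * C.m) => C.up j ∈ R),
              N j ∉ (univ.filter fun j : Fin (2 * C.m) => C.up j ∈ R))) ∧
          ∀ S : Finset (Fin (2 * C.m)), 2 * C.m < 3 * S.card → 3 * S.card ≤ 4 * C.m →
            (4 * (2 ^ ((Nat.log 2 n + c) ^ c) + 1) * (C.m + 1) ^ 2) *
              (BB.filter fun y => ∀ i, i ∈ S ↔ f y i ∈ S).card < BB.card) :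
    ∀ c : ℕ, ∃ n₀ : ℕ, ∀ n ≥ n₀, ∀ R : Finset (Fin (2 * n)), a * R.card ≤ 2 * n →
      (¬ ∃ s : ℕ, s + (2 * ((Nat.log 2 n + c) ^ c + Nat.log 2 n + 1) ^ 6 + 12) ≤ 2 * n ∧
        ∀ j : Fin (2 * n), s ≤ j.val →
          j.val < s + (2 * ((Nat.log 2 n + c) ^ c + Nat.log 2 n + 1) ^ 6 + 12) → j ∉ R) →
      ∀ p : MvPolynomial (Fin (2 * n) × Fin (2 * n)) ℝ≥0, p ≠ 0 → a * p.totalDegree ≤ n →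
        (∀ d ∈ p.support, ∀ e ∈ d.support, e.1 ∈ R ∧ e.2 ∈ R) →
          2 ^ ((Nat.log 2 n + c) ^ c) < complexity (nestFreeMatchingPoly n ℝ≥0 * p) := by
  classical
  refine denseInternalHard_of_excisedAvoidingSpread a fun c => ?_
  obtain ⟨n₀, hn₀⟩ := h c
  refine ⟨max n₀ 5, fun n hn R hR hrun => ?_⟩
  have hn5 : 5 ≤ n := le_of_max_le_right hn
  -- `14|R| + 10 ≤ 2n` from `a|R| ≤ 2n`, `a ≥ 28`, `n ≥ 5`
  have hR14 : 14 * R.card + 10 ≤ 2 * n := by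
    have h1 : 28 * R.card ≤ 2 * n := (Nat.mul_le_mul_right _ ha).trans hR
    omega
  obtain ⟨C, hsize, hm3, ⟨M₀, hM₀, hR₀, hout⟩, hS0⟩ := exists_good_carving R hR14
  obtain ⟨B, BB, f, hBB, hf, hcount⟩ := hn₀ n (le_of_max_le_left hn) R hR hrun C hm3 hsize hS0
  set 𝓕' := (nestFreeMatchings (2 * C.m)).filter
    (fun N => ∀ j ∈ (univ.filter fun j : Fin (2 * C.m) => C.up j ∈ R),
      N j ∉ (univ.filter fun j : Fin (2 * C.m) => C.up j ∈ R)) with h𝓕'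
  refine ⟨C, hm3, M₀, hM₀, hR₀, hout,
    fun N => ((BB.filter fun y => f y = N).card : ℝ≥0) / (BB.card : ℝ≥0),
    pushforward_mass_one hBB f hf, fun S hS1 hS2 => ?_⟩
  refine pushforward_event_lt_of_count hBB f 𝓕' (fun N => ∀ i, i ∈ S ↔ N i ∈ S) ?_
  have hset : (BB.filter fun y => f y ∈ 𝓕' ∧ ∀ i, i ∈ S ↔ f y i ∈ S) =
      (BB.filter fun y => ∀ i, i ∈ S ↔ f y i ∈ S) :=
    filter_congr fun y hy => and_iff_right (hf y hy)
  rw [hset]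
  exact hcount S hS1 hS2


/-- **Per-instance form (serves every rung: S2b's `2^((log₂ n + c)^c)` as well as the exponent-2 rung
`stmt-ValiantsHypothesis-24468`, `2^((log₂ n)^2 / b)`).**  For ONE `n`, ONE defect set `R` with
`14·|R| + 10 ≤ 2n`, ONE internal cofactor `p ≠ 0` and ANY threshold `K`: if for every carving `C` of `[2n]` with
good ends (S0), `3 ≤ C.m` and `2n ≤ 2·C.m + 12|R| + 4` one exhibits seeds `BB ≠ ∅`, a map `f` into the
`R'`-avoiding nest-free perfect matchings of `Fin (2·C.m)` and the counts
`4(K+1)(C.m+1)²·#{y ∈ BB : f y respects S} < #BB` for all balanced `S`, then `K < L₊(NN_n · p)`. [folklore] -/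
theorem lt_complexity_of_counts {n : ℕ} (R : Finset (Fin (2 * n))) (hR : 14 * R.card + 10 ≤ 2 * n) (K : ℕ)
    {p : MvPolynomial (Fin (2 * n) × Fin (2 * n)) ℝ≥0} (hp : p ≠ 0)
    (hint : ∀ d ∈ p.support, ∀ e ∈ d.support, e.1 ∈ R ∧ e.2 ∈ R)
    (h : ∀ C : Carving n, 3 ≤ C.m → 2 * n ≤ 2 * C.m + 12 * R.card + 4 →
        (∀ t ≤ 2 * C.m,
          4 * ((univ.filter fun j : Fin (2 * C.m) => C.up j ∈ R).filter fun j => j.val < t).card ≤ t ∧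
          4 * ((univ.filter fun j : Fin (2 * C.m) => C.up j ∈ R).filter
            fun j => 2 * C.m ≤ j.val + t).card ≤ t) →
        ∃ B : ℕ, ∃ BB : Finset (Fin B → Bool), ∃ f : (Fin B → Bool) → (Fin (2 * C.m) → Fin (2 * C.m)),
          BB.Nonempty ∧
          (∀ y ∈ BB, f y ∈ (nestFreeMatchings (2 * C.m)).filter
            (fun N => ∀ j ∈ (univ.filter fun j : Fin (2 * C.m) => C.up j ∈ R),
              N j ∉ (univ.filter fun j : Fin (2 * C.m) => C.up j ∈ R))) ∧
          ∀ S : Finset (Fin (2 * C.m)), 2 * C.m < 3 * S.card → 3 * S.card ≤ 4 * C.m →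
            (4 * (K + 1) * (C.m + 1) ^ 2) *
              (BB.filter fun y => ∀ i, i ∈ S ↔ f y i ∈ S).card < BB.card) :
    K < complexity (nestFreeMatchingPoly n ℝ≥0 * p) := by
  classical
  obtain ⟨C, hsize, hm3, ⟨M₀, hM₀, hR₀, hout⟩, hS0⟩ := exists_good_carving R hR
  obtain ⟨B, BB, f, hBB, hf, hcount⟩ := h C hm3 hsize hS0
  set 𝓕' := (nestFreeMatchings (2 * C.m)).filter
    (fun N => ∀ j ∈ (univ.filter fun j : Fin (2 * C.m) => C.up j ∈ R),
      N j ∉ (univ.filter fun j : Fin (2 * C.m) => C.up j ∈ R)) with h𝓕'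
  have h𝓕sub : 𝓕' ⊆ perfectMatchings (2 * C.m) :=
    (filter_subset _ _).trans nestFreeMatchings_subset_perfectMatchings
  set μ : (Fin (2 * C.m) → Fin (2 * C.m)) → ℝ≥0 := fun N =>
    ((BB.filter fun y => f y = N).card : ℝ≥0) / (BB.card : ℝ≥0) with hμ
  have hμ1 : ∑ N ∈ 𝓕', μ N = 1 := pushforward_mass_one hBB f hf
  by_contra hle
  push Not at hle
  have hP : complexity (∑ N ∈ 𝓕', arcMonomial ℝ≥0 N) ≤ K + 1 :=
    (complexity_excised_le_mul_internal C R hM₀ hR₀ hout hp hint).trans (Nat.add_le_add_right hle 1)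
  obtain ⟨S, h1, h2, hbig⟩ := exists_balanced_split_of_complexity_family hm3 h𝓕sub μ hμ1
  have hlt : ((4 * (K + 1) * (C.m + 1) ^ 2 : ℕ) : ℝ≥0) *
      (∑ N ∈ 𝓕'.filter (fun N => ∀ i, i ∈ S ↔ N i ∈ S), μ N) < 1 := by
    refine pushforward_event_lt_of_count hBB f 𝓕' (fun N => ∀ i, i ∈ S ↔ N i ∈ S) ?_
    have hset : (BB.filter fun y => f y ∈ 𝓕' ∧ ∀ i, i ∈ S ↔ f y i ∈ S) =
        (BB.filter fun y => ∀ i, i ∈ S ↔ f y i ∈ S) :=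
      filter_congr fun y hy => and_iff_right (hf y hy)
    rw [hset]
    exact hcount S h1 h2
  have hmono : ((4 * complexity (∑ N ∈ 𝓕', arcMonomial ℝ≥0 N) * (C.m + 1) ^ 2 : ℕ) : ℝ≥0) ≤
      ((4 * (K + 1) * (C.m + 1) ^ 2 : ℕ) : ℝ≥0) := by
    exact_mod_cast Nat.mul_le_mul_right _ (Nat.mul_le_mul_left _ hP)
  exact absurd (lt_of_le_of_lt (hbig.trans (mul_le_mul_of_nonneg_right hmono zero_le)) hlt)
    (lt_irrefl _)


/-- **The exponent-2 rung from counts (`stmt-ValiantsHypothesis-24468`, SPEC §S11, VERBATIM shape with the route's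
inlined `NN_n`).**  If `a ≥ 28`, `0 < b`, and from some `n₀` on every admissible `R` (`a·|R| ≤ 2n`) and every carving with
good ends admit seeds, a map into the `R'`-avoiding nest-free perfect matchings and the counts with threshold
`K = 2^((log₂ n)^2 / b)`, then `NNInternalCofactorQuasiPolyHard` holds with these `a, b` (closing file: `exact` this, the
inlined sum being `nestFreeMatchingPoly n ℝ≥0` by `rfl`).  Nothing here proves the counts ((D‴)/(B‴) of the D3plan). [folklore] -/
theorem quasiPolyHard_of_counts (a b n₀ : ℕ) (ha : 28 ≤ a) (hb : 0 < b)
    (h : ∀ n ≥ n₀, ∀ R : Finset (Fin (2 * n)), a * R.card ≤ 2 * n →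
      ∀ C : Carving n, 3 ≤ C.m → 2 * n ≤ 2 * C.m + 12 * R.card + 4 →
        (∀ t ≤ 2 * C.m,
          4 * ((univ.filter fun j : Fin (2 * C.m) => C.up j ∈ R).filter fun j => j.val < t).card ≤ t ∧
          4 * ((univ.filter fun j : Fin (2 * C.m) => C.up j ∈ R).filter
            fun j => 2 * C.m ≤ j.val + t).card ≤ t) →
        ∃ B : ℕ, ∃ BB : Finset (Fin B → Bool), ∃ f : (Fin B → Bool) → (Fin (2 * C.m) → Fin (2 * C.m)),
          BB.Nonempty ∧
          (∀ y ∈ BB, f y ∈ (nestFreeMatchings (2 * C.m)).filter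
            (fun N => ∀ j ∈ (univ.filter fun j : Fin (2 * C.m) => C.up j ∈ R),
              N j ∉ (univ.filter fun j : Fin (2 * C.m) => C.up j ∈ R))) ∧
          ∀ S : Finset (Fin (2 * C.m)), 2 * C.m < 3 * S.card → 3 * S.card ≤ 4 * C.m →
            (4 * (2 ^ ((Nat.log 2 n) ^ 2 / b) + 1) * (C.m + 1) ^ 2) *
              (BB.filter fun y => ∀ i, i ∈ S ↔ f y i ∈ S).card < BB.card) :
    ∃ a b n₀ : ℕ, 0 < b ∧ ∀ n ≥ n₀, ∀ R : Finset (Fin (2 * n)), a * R.card ≤ 2 * n →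
      ∀ p : MvPolynomial (Fin (2 * n) × Fin (2 * n)) NNReal, p ≠ 0 →
        (∀ d ∈ p.support, ∀ e ∈ d.support, e.1 ∈ R ∧ e.2 ∈ R) →
          2 ^ ((Nat.log 2 n) ^ 2 / b) <
            Literature.Computability.AlgebraicComplexity.complexity
              ((∑ M : Fin (2 * n) → Fin (2 * n),
                if ((∀ i, M (M i) = i) ∧ (∀ i, M i ≠ i) ∧ ∀ i j, i < j → j < M j → M j < M i → False) then
                  ∏ i : Fin (2 * n), (if i < M i then MvPolynomial.X (i, M i) else 1)
                else (0 : MvPolynomial (Fin (2 * n) × Fin (2 * n)) NNReal)) * p) := by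
  refine ⟨a, b, max n₀ 5, hb, fun n hn R hR p hp hint => ?_⟩
  have hn5 : 5 ≤ n := le_of_max_le_right hn
  have hR14 : 14 * R.card + 10 ≤ 2 * n := by
    have h1 : 28 * R.card ≤ 2 * n := (Nat.mul_le_mul_right _ ha).trans hR
    omega
  show 2 ^ ((Nat.log 2 n) ^ 2 / b) < complexity (nestFreeMatchingPoly n ℝ≥0 * p)
  exact lt_complexity_of_counts R hR14 _ hp hint
    (fun C hm3 hsize hS0 => h n (le_of_max_le_left hn) R hR C hm3 hsize hS0)

end Summit.ValiantsHypothesis.ValiantsHypothesis.Theorems.FifoMatching.NNLinearDegreeCofactorHard.InternalCofactor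

end
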